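import Literature.Analysis.FluidPDE.BilliardTensorTrace
import Literature.Analysis.FluidPDE.HardSphereTrajectoryMeasurable
import Literature.Analysis.FluidPDE.ReynoldsDefectMeasure
import HarnessLib

/-!
# Serre's mass–momentum tensor of a billiard as a matrix-valued measure on `ℝ × T^d`

The object behind the tested identities of `BilliardTensorDivFree`, `BilliardTensorTrace` and
`BilliardTensorPositivity`: D. Serre's **mass–momentum tensor with collitons** of a hard-sphere
motion on the flat torus over a time window (Serre 2021 §2; Serre 2024 §5 p. 1438),

`M = Σ_p (1, v_p) ⊗ (1, v_p) dt|_{γ(p)} + Σ_coll (1/|[v]|) (0, [v]) ⊗ (0, [v]) dℓ|_{[x_q, x_p]}`,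

as a `(1 + d) × (1 + d)` matrix of finite signed measures on `ℝ × T^d`
(`Literature.Analysis.FluidPDE.MatrixMeasure (Option d) (ℝ × UnitAddTorus d)`, index `none` =
time, `some i` = the space direction `i`):

* `stVec c v` — the space–time vector `(c, v)` indexed by `Option d`; `particleEntry γ a b p α β` —
  `(u_p)_α (u_p)_β dt` (`u_p = (1, v_p(t))`) on `[a, b]` pushed forward by `t ↦ (t, x_p(t))`
  (`Measure.withDensityᵥ`, `VectorMeasure.map`; `IsHardSphereTrajectory.measurable`);
  `particleTensor = Σ_p`; `collitonSegment τ x n` — unit mass on `s ↦ (τ, x + proj(s n))`,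
  `s ∈ [0,1]`; `collitonWeight = ½ (ε/|Δv_i|) [Δv_i]_α [Δv_i]_β` (time components `0`);
  `collitonTensor` — sum over collision times in `(a, b]` and colliding ordered pairs;
  **`billiardTensor ε γ a b`** — `M`.
* `particleEntry_apply`, `collitonTensor_apply` — values on (measurable) sets;
  **`IsHardSphereTrajectory.billiardTensor_isPosSemidef`** — `M ⪰ 0`; Serre's (17) for `M` is in
  the companion `BilliardTensorMeasureTrace`; the identification of `MatrixMeasure.pairing M G`
  with the tested functionals of `BilliardTensorDivFree` etc. is not done here.

## References

* D. Serre, *Compensated integrability on tori; a priori estimate for space-periodic gas flows*,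
  C. R. Math. Acad. Sci. Paris 362 (2024) 1425–1444, §5 p. 1438, (17). [Serre2024]
* D. Serre, *Hard spheres dynamics: weak vs strong collisions*, ARMA 240 (2021) 243–264, §2. [Serre2021]
-/

open Set Filter Function MeasureTheory
open scoped InnerProductSpace Topology

namespace Literature.Analysis.FluidPDE

noncomputable section

open Literature.Analysis.FunctionSpaces

section NoFintype

variable {d : Type*} {N : ℕ}

/-- The space–time vector `(c, v)` indexed by `Option d` (`none` = time component `c`,
`some i` = `v_i`). [folklore] -/
def stVec (c : ℝ) (v : EuclideanSpace ℝ d) : Option d → ℝ := fun o => o.elim c fun i => v i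

/-- Time component. [folklore] -/
@[simp] theorem stVec_none (c : ℝ) (v : EuclideanSpace ℝ d) : stVec c v none = c := rfl

/-- Space components. [folklore] -/
@[simp] theorem stVec_some (c : ℝ) (v : EuclideanSpace ℝ d) (i : d) : stVec c v (some i) = v i := rfl

end NoFintype

variable {d : Type*} [Fintype d] {N : ℕ}
/-- Components of `(c, v)` are bounded by `max |c| ‖v‖`. [folklore] -/
theorem abs_stVec_le (c : ℝ) (v : EuclideanSpace ℝ d) (o : Option d) : |stVec c v o| ≤ max |c| ‖v‖ := by
  cases o with
  | none => exact le_max_left _ _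
  | some i =>
    refine le_trans ?_ (le_max_right _ _)
    rw [stVec_some, EuclideanSpace.norm_eq]
    refine Real.abs_le_sqrt ?_
    have h := Finset.single_le_sum (f := fun j => ‖v j‖ ^ 2) (fun j _ => sq_nonneg _)
      (Finset.mem_univ i)
    simpa only [Real.norm_eq_abs, sq_abs] using h

/-! ## The particle part -/
section Particle

variable (γ : ℝ → Config N d (UnitAddTorus d))

/-- The density `(u_p)_α (u_p)_β (t)` of the particle `p`, `u_p = (1, v_p(t))`. [cite: Serre2024, §5 p. 1438] -/
def particleDensity (p : Fin N) (α β : Option d) (t : ℝ) : ℝ :=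
  stVec 1 (γ t p).2 α * stVec 1 (γ t p).2 β

/-- The space–time graph map of the particle `p`: `t ↦ (t, x_p(t))`. [folklore] -/
def graphMap (p : Fin N) (t : ℝ) : ℝ × UnitAddTorus d := (t, (γ t p).1)

/-- **The particle entry** `(M^p)_{αβ} = (u_p)_α (u_p)_β dt|_{γ(p)}` over the window `[a, b]`:
the signed measure with density `(u_p)_α (u_p)_β` with respect to `dt` on `[a, b]`, pushed forward
to `ℝ × T^d` along the graph of the particle. [cite: Serre2024, §5 p. 1438] -/
def particleEntry (a b : ℝ) (p : Fin N) (α β : Option d) : SignedMeasure (ℝ × UnitAddTorus d) :=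
  ((volume.restrict (Icc a b)).withDensityᵥ (particleDensity γ p α β)).map (graphMap γ p)

/-- **The particle part** `Σ_p (1, v_p) ⊗ (1, v_p) dt|_{γ(p)}` of Serre's tensor over `[a, b]`.
[cite: Serre2024, §5 p. 1438] -/
def particleTensor (a b : ℝ) : MatrixMeasure (Option d) (ℝ × UnitAddTorus d) :=
  Matrix.of fun α β => ∑ p : Fin N, particleEntry γ a b p α β

variable {γ}

omit [Fintype d] in
/-- The particle density is symmetric in the indices. [folklore] -/
theorem particleDensity_comm (p : Fin N) (α β : Option d) (t : ℝ) :
    particleDensity γ p α β t = particleDensity γ p β α t :=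
  mul_comm _ _

namespace IsHardSphereTrajectory

variable {ε : ℝ}

/-- The graph map of a particle is measurable (positions are continuous). [folklore] -/
theorem measurable_graphMap (h : IsHardSphereTrajectory (Torus.geometry d) ε N γ) (p : Fin N) :
    Measurable (graphMap γ p) :=
  measurable_id.prodMk (h.pos_continuous p).measurable

/-- Components of the velocities are measurable in time. [folklore] -/
theorem measurable_stVec_vel (h : IsHardSphereTrajectory (Torus.geometry d) ε N γ) (p : Fin N)
    (α : Option d) : Measurable fun t => stVec 1 (γ t p).2 α := by
  cases α with
  | none => exact measurable_const
  | some i =>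
    simp only [stVec_some]
    exact (EuclideanSpace.proj i).continuous.measurable.comp (h.measurable_vel (fun _ =>
      continuous_const.add Torus.continuous_proj) p)

/-- The particle densities are bounded by `max 1 (2E)` (`|v_i| ≤ |v| ≤ √(2E)`). [folklore] -/
theorem abs_particleDensity_le (h : IsHardSphereTrajectory (Torus.geometry d) ε N γ) (p : Fin N)
    (α β : Option d) (a t : ℝ) :
    |particleDensity γ p α β t| ≤ max 1 (2 * configEnergy (γ a)) := by
  have hv : ‖(γ t p).2‖ ^ 2 ≤ 2 * configEnergy (γ a) := by
    rw [IsHardSphereTrajectory.configEnergy_eq_holds h a t]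
    have hsum : ‖(γ t p).2‖ ^ 2 ≤ ∑ k, ‖(γ t k).2‖ ^ 2 :=
      Finset.single_le_sum (f := fun k => ‖(γ t k).2‖ ^ 2) (fun _ _ => sq_nonneg _)
        (Finset.mem_univ p)
    have hE : ∑ k, ‖(γ t k).2‖ ^ 2 = 2 * configEnergy (γ t) := by
      simp only [configEnergy]
      ring
    linarith
  have hm : |stVec 1 (γ t p).2 α| * |stVec 1 (γ t p).2 β| ≤ max 1 ‖(γ t p).2‖ * max 1 ‖(γ t p).2‖ := by
    have h1 := abs_stVec_le 1 (γ t p).2 α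
    have h2 := abs_stVec_le 1 (γ t p).2 β
    rw [abs_one] at h1 h2
    exact mul_le_mul h1 h2 (abs_nonneg _) ((zero_le_one.trans (le_max_left _ _)))
  rw [particleDensity, abs_mul]
  refine hm.trans ?_
  rcases le_total 1 ‖(γ t p).2‖ with h1 | h1
  · rw [max_eq_right h1, ← sq]
    exact hv.trans (le_max_right _ _)
  · rw [max_eq_left h1, mul_one]
    exact le_max_left _ _

/-- The particle densities are integrable on the window. [folklore] -/
theorem integrable_particleDensity (h : IsHardSphereTrajectory (Torus.geometry d) ε N γ) (p : Fin N)
    (α β : Option d) (a b : ℝ) :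
    Integrable (particleDensity γ p α β) (volume.restrict (Icc a b)) := by
  have hmeas : Measurable (particleDensity γ p α β) :=
    (h.measurable_stVec_vel p α).mul (h.measurable_stVec_vel p β)
  refine IntegrableOn.of_bound (measure_Icc_lt_top) hmeas.aestronglyMeasurable
    (max 1 (2 * configEnergy (γ a))) (Eventually.of_forall fun t => ?_)
  rw [Real.norm_eq_abs]
  exact h.abs_particleDensity_le p α β a t

/-- **Values of a particle entry**: on a measurable set `A ⊆ ℝ × T^d`,
`(M^p)_{αβ}(A) = ∫_{t ∈ [a,b], (t, x_p t) ∈ A} (u_p)_α (u_p)_β dt`. [folklore] -/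
theorem particleEntry_apply (h : IsHardSphereTrajectory (Torus.geometry d) ε N γ) (a b : ℝ)
    (p : Fin N) (α β : Option d) {A : Set (ℝ × UnitAddTorus d)} (hA : MeasurableSet A) :
    particleEntry γ a b p α β A =
      ∫ t in Icc a b ∩ graphMap γ p ⁻¹' A, particleDensity γ p α β t := by
  rw [particleEntry, VectorMeasure.map_apply _ (h.measurable_graphMap p) hA,
    withDensityᵥ_apply (h.integrable_particleDensity p α β a b) ((h.measurable_graphMap p) hA),
    Measure.restrict_restrict' measurableSet_Icc, inter_comm]

/-- Values of finite sums of signed measures. [folklore] -/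
theorem _root_.Literature.Analysis.FluidPDE.signedMeasure_sum_apply {X ι : Type*} [MeasurableSpace X]
    (s : Finset ι) (v : ι → SignedMeasure X) (A : Set X) : (∑ i ∈ s, v i) A = ∑ i ∈ s, v i A := by
  classical
  induction s using Finset.induction_on with
  | empty => simp
  | insert x s hx ih => rw [Finset.sum_insert hx, Finset.sum_insert hx, FunLike.coe_add, Pi.add_apply, ih]

/-- A Gram-type matrix `(∫_T ρ_α ρ_β)_{αβ}` with a symmetric rank-one integrand is positive
semidefinite: `xᵀ G x = ∫_T (Σ_α x_α ρ_α)² ≥ 0`. [folklore] -/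
theorem _root_.Literature.Analysis.FluidPDE.posSemidef_of_integral_mul {ι : Type*} [Fintype ι]
    [DecidableEq ι] {T : Set ℝ} (hT : MeasurableSet T) (ρ : ι → ℝ → ℝ)
    (hint : ∀ α β, IntegrableOn (fun t => ρ α t * ρ β t) T volume) :
    (Matrix.of fun α β => ∫ t in T, ρ α t * ρ β t).PosSemidef := by
  refine Matrix.PosSemidef.of_dotProduct_mulVec_nonneg ?_ fun x => ?_
  · rw [Matrix.IsHermitian, Matrix.conjTranspose_eq_transpose_of_trivial]
    ext α β
    simp only [Matrix.transpose_apply, Matrix.of_apply, mul_comm]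
  · have hterm : ∀ α β, x α * ((∫ t in T, ρ α t * ρ β t) * x β) =
        ∫ t in T, x α * x β * (ρ α t * ρ β t) := by
      intro α β
      calc x α * ((∫ t in T, ρ α t * ρ β t) * x β) = (x α * x β) * ∫ t in T, ρ α t * ρ β t := by
            ring
        _ = ∫ t in T, x α * x β * (ρ α t * ρ β t) := (integral_const_mul _ _).symm
    have hswap : ∑ α, ∑ β, ∫ t in T, x α * x β * (ρ α t * ρ β t) =
        ∫ t in T, ∑ α, ∑ β, x α * x β * (ρ α t * ρ β t) := by
      rw [integral_finsetSum _ (fun α _ => integrable_finsetSum _ fun β _ =>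
        (hint α β).const_mul (x α * x β))]
      exact Finset.sum_congr rfl fun α _ =>
        (integral_finsetSum _ (fun β _ => (hint α β).const_mul (x α * x β))).symm
    have hpt : ∀ t, ∑ α, ∑ β, x α * x β * (ρ α t * ρ β t) = (∑ α, x α * ρ α t) ^ 2 := by
      intro t
      rw [sq, Finset.sum_mul_sum]
      exact Finset.sum_congr rfl fun α _ => Finset.sum_congr rfl fun β _ => by ring
    have hq : dotProduct (star x) ((Matrix.of fun α β => ∫ t in T, ρ α t * ρ β t).mulVec x) =
        ∑ α, ∑ β, x α * ((∫ t in T, ρ α t * ρ β t) * x β) := by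
      simp only [dotProduct, Matrix.mulVec, star_trivial, Matrix.of_apply, Finset.mul_sum]
    rw [hq]
    simp_rw [hterm]
    rw [hswap]
    simp_rw [hpt]
    exact setIntegral_nonneg hT fun t _ => sq_nonneg _

/-- The value matrix of the particle part on a measurable set is the sum over the particles of
the Gram-type matrices `∫ u_p ⊗ u_p dt`, hence **positive semidefinite**. [folklore] -/
theorem posSemidef_particleTensor_eval (h : IsHardSphereTrajectory (Torus.geometry d) ε N γ)
    (a b : ℝ) {A : Set (ℝ × UnitAddTorus d)} (hA : MeasurableSet A) :
    ((particleTensor γ a b).eval A).PosSemidef := by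
  classical
  have heval : (particleTensor γ a b).eval A =
      ∑ p : Fin N, Matrix.of fun α β =>
        ∫ t in Icc a b ∩ graphMap γ p ⁻¹' A, stVec 1 (γ t p).2 α * stVec 1 (γ t p).2 β := by
    ext α β
    simp only [MatrixMeasure.eval_apply, particleTensor, Matrix.of_apply, Matrix.sum_apply,
      signedMeasure_sum_apply, h.particleEntry_apply a b _ α β hA, particleDensity]
  rw [heval]
  refine Matrix.posSemidef_sum _ fun p _ => ?_
  have hTm : MeasurableSet (Icc a b ∩ graphMap γ p ⁻¹' A) :=
    measurableSet_Icc.inter ((h.measurable_graphMap p) hA)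
  refine posSemidef_of_integral_mul hTm (fun α t => stVec 1 (γ t p).2 α) fun α β => ?_
  exact (h.integrable_particleDensity p α β a b).mono_measure
    (Measure.restrict_mono inter_subset_left le_rfl)

end IsHardSphereTrajectory

end Particle

/-! ## The collitons -/
section Colliton

/-- The unit-mass signed (indeed positive) measure carried by the space–time segment
`s ↦ (τ, x + proj(s n))`, `s ∈ [0, 1]` (the contact segment at the collision time `τ`; arc
length is `|n| ds = ε ds`, the factor `ε` being put into the weight). [cite: Serre2024, §5 p. 1438] -/
def collitonSegment (τ : ℝ) (x : UnitAddTorus d) (n : EuclideanSpace ℝ d) :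
    SignedMeasure (ℝ × UnitAddTorus d) :=
  ((volume.restrict (Icc (0 : ℝ) 1)).toSignedMeasure).map fun s : ℝ => (τ, x + Torus.proj (s • n))

/-- The segment map is measurable (continuous). [folklore] -/
theorem measurable_segmentMap (τ : ℝ) (x : UnitAddTorus d) (n : EuclideanSpace ℝ d) :
    Measurable fun s : ℝ => ((τ, x + Torus.proj (s • n)) : ℝ × UnitAddTorus d) :=
  (continuous_const.prodMk (continuous_const.add
    (Torus.continuous_proj.comp (continuous_id.smul continuous_const)))).measurable

/-- Values of the segment measure: the Lebesgue measure of the parameters `s ∈ [0, 1]` whose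
point lies in `A`; in particular nonnegative and at most `1`. [folklore] -/
theorem collitonSegment_apply (τ : ℝ) (x : UnitAddTorus d) (n : EuclideanSpace ℝ d)
    {A : Set (ℝ × UnitAddTorus d)} (hA : MeasurableSet A) :
    collitonSegment τ x n A =
      (volume.restrict (Icc (0 : ℝ) 1)).real
        ((fun s : ℝ => ((τ, x + Torus.proj (s • n)) : ℝ × UnitAddTorus d)) ⁻¹' A) := by
  rw [collitonSegment, VectorMeasure.map_apply _ (measurable_segmentMap τ x n) hA,
    Measure.toSignedMeasure_apply_measurable ((measurable_segmentMap τ x n) hA)]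

/-- The segment measure is nonnegative. [folklore] -/
theorem collitonSegment_nonneg (τ : ℝ) (x : UnitAddTorus d) (n : EuclideanSpace ℝ d)
    {A : Set (ℝ × UnitAddTorus d)} (hA : MeasurableSet A) : 0 ≤ collitonSegment τ x n A := by
  rw [collitonSegment_apply τ x n hA]
  exact measureReal_nonneg

/-- The segment measure has total mass `1`. [folklore] -/
theorem collitonSegment_univ (τ : ℝ) (x : UnitAddTorus d) (n : EuclideanSpace ℝ d) :
    collitonSegment τ x n univ = 1 := by
  rw [collitonSegment_apply τ x n MeasurableSet.univ, preimage_univ, Measure.real,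
    Measure.restrict_apply_univ, Real.volume_Icc, sub_zero, ENNReal.toReal_ofReal zero_le_one]

/-- **The colliton weights**: `½ (ε/|Δv_i|) [Δv_i]_α [Δv_i]_β` with `[Δv_i] = (0, Δv_i)` the
space–time momentum exchange of the particle `i` (no time component), `ε` for the arc length and
`½` for the two orientations of a colliding pair. [cite: Serre2024, §5 p. 1438] -/
def collitonWeight (ε : ℝ) (pre post : Config N d (UnitAddTorus d)) (i : Fin N)
    (α β : Option d) : ℝ :=
  2⁻¹ * (ε / ‖(post i).2 - (pre i).2‖) *
    (stVec 0 ((post i).2 - (pre i).2) α * stVec 0 ((post i).2 - (pre i).2) β)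

/-- The colliton entries at a (collision) time `t` of the curve `γ`: the sum over the colliding
ordered pairs `(i, j)` of `collitonWeight · (segment from x_j towards x_i)`.
[cite: Serre2024, §5 p. 1438] -/
def collitonEntryAt (ε : ℝ) (γ : ℝ → Config N d (UnitAddTorus d)) (t : ℝ) (α β : Option d) :
    SignedMeasure (ℝ × UnitAddTorus d) :=
  ∑ p ∈ collidingPairs (Torus.geometry d) ε (γ t),
    collitonWeight ε (leftLim γ t) (γ t) p.1 α β •
      collitonSegment t (γ t p.2).1 ((Torus.geometry d).sepVec (γ t p.1).1 (γ t p.2).1)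

/-- **The colliton part** of Serre's tensor over the window: the sum of the colliton entries over
the collision times in `(a, b]` (a `finsum`; finite on hard-sphere trajectories).
[cite: Serre2024, §5 p. 1438] -/
def collitonTensor (ε : ℝ) (γ : ℝ → Config N d (UnitAddTorus d)) (a b : ℝ) :
    MatrixMeasure (Option d) (ℝ × UnitAddTorus d) :=
  Matrix.of fun α β => ∑ᶠ t ∈ collisionTimes (Torus.geometry d) ε γ ∩ Ioc a b, collitonEntryAt ε γ t α β

/-- **Serre's mass–momentum tensor with collitons** `M` of the curve `γ` (diameter `ε`) over
the window, as a matrix-valued measure on `ℝ × T^d`. [cite: Serre2024, §5 p. 1438] -/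
def billiardTensor (ε : ℝ) (γ : ℝ → Config N d (UnitAddTorus d)) (a b : ℝ) :
    MatrixMeasure (Option d) (ℝ × UnitAddTorus d) :=
  particleTensor γ a b + collitonTensor ε γ a b

/-- The value matrix of a single colliton term is a nonnegative multiple of the rank-one matrix
`[Δv] ⊗ [Δv]`, hence positive semidefinite (`ε ≥ 0`). [folklore] -/
theorem posSemidef_collitonTerm {ε : ℝ} (hε : 0 ≤ ε) (pre post : Config N d (UnitAddTorus d))
    (i : Fin N) {m : ℝ} (hm : 0 ≤ m) :
    (Matrix.of fun α β : Option d => collitonWeight ε pre post i α β * m).PosSemidef := by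
  classical
  set z : Option d → ℝ := stVec 0 ((post i).2 - (pre i).2) with hz
  set c : ℝ := 2⁻¹ * (ε / ‖(post i).2 - (pre i).2‖) * m with hc
  have hc0 : 0 ≤ c := by positivity
  have hmat : (Matrix.of fun α β : Option d => collitonWeight ε pre post i α β * m) =
      Matrix.of fun α β => c * (z α * z β) := by
    ext α β
    simp only [Matrix.of_apply, collitonWeight, hc, hz]
    ring
  rw [hmat]
  refine Matrix.PosSemidef.of_dotProduct_mulVec_nonneg ?_ fun x => ?_
  · rw [Matrix.IsHermitian, Matrix.conjTranspose_eq_transpose_of_trivial]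
    ext α β
    simp only [Matrix.transpose_apply, Matrix.of_apply, mul_comm (z α)]
  · have hq : dotProduct (star x) ((Matrix.of fun α β : Option d => c * (z α * z β)).mulVec x) =
        c * (∑ α, x α * z α) ^ 2 := by
      simp only [dotProduct, Matrix.mulVec, star_trivial, Matrix.of_apply, Finset.mul_sum, sq,
        Finset.sum_mul]
      exact Finset.sum_congr rfl fun α _ => Finset.sum_congr rfl fun β _ => by ring
    rw [hq]
    exact mul_nonneg hc0 (sq_nonneg _)

namespace IsHardSphereTrajectory

variable {ε : ℝ} {γ : ℝ → Config N d (UnitAddTorus d)}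

/-- Values of the colliton part on a measurable set along a hard-sphere trajectory: a finite sum
over the collision times in `(a, b]` and the colliding pairs. [folklore] -/
theorem collitonTensor_apply (h : IsHardSphereTrajectory (Torus.geometry d) ε N γ) (a b : ℝ)
    (α β : Option d) (A : Set (ℝ × UnitAddTorus d)) :
    collitonTensor ε γ a b α β A =
      ∑ t ∈ (h.finite_collisionTimes_inter_Ioc a b).toFinset,
        ∑ p ∈ collidingPairs (Torus.geometry d) ε (γ t),
          collitonWeight ε (leftLim γ t) (γ t) p.1 α β *
            collitonSegment t (γ t p.2).1 ((Torus.geometry d).sepVec (γ t p.1).1 (γ t p.2).1) A := by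
  classical
  rw [collitonTensor, Matrix.of_apply,
    finsum_mem_eq_finite_toFinset_sum _ (h.finite_collisionTimes_inter_Ioc a b),
    signedMeasure_sum_apply]
  refine Finset.sum_congr rfl fun t _ => ?_
  rw [collitonEntryAt, signedMeasure_sum_apply]
  refine Finset.sum_congr rfl fun p _ => ?_
  rw [FunLike.coe_smul, Pi.smul_apply, smul_eq_mul]

/-- The value matrix of the colliton part on a measurable set is positive semidefinite
(`ε ≥ 0`). [folklore] -/
theorem posSemidef_collitonTensor_eval (h : IsHardSphereTrajectory (Torus.geometry d) ε N γ)
    (hε : 0 ≤ ε) (a b : ℝ) {A : Set (ℝ × UnitAddTorus d)} (hA : MeasurableSet A) :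
    ((collitonTensor ε γ a b).eval A).PosSemidef := by
  classical
  have heval : (collitonTensor ε γ a b).eval A =
      ∑ t ∈ (h.finite_collisionTimes_inter_Ioc a b).toFinset,
        ∑ p ∈ collidingPairs (Torus.geometry d) ε (γ t),
          Matrix.of fun α β => collitonWeight ε (leftLim γ t) (γ t) p.1 α β *
            collitonSegment t (γ t p.2).1 ((Torus.geometry d).sepVec (γ t p.1).1 (γ t p.2).1) A := by
    ext α β
    simp only [MatrixMeasure.eval_apply, h.collitonTensor_apply a b α β A, Matrix.sum_apply,
      Matrix.of_apply]
  rw [heval]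
  refine Matrix.posSemidef_sum _ fun t _ => Matrix.posSemidef_sum _ fun p _ => ?_
  exact posSemidef_collitonTerm hε _ _ _ (collitonSegment_nonneg _ _ _ hA)

/-- **`M ⪰ 0`.** Along a hard-sphere trajectory on `T^d` (`ε ≥ 0`), Serre's mass–momentum tensor
with collitons is a positive semidefinite matrix-valued measure: a nonnegative combination of
rank-one tensors `u ⊗ u` (`(1, v_p) ⊗ (1, v_p) dt` and `[Δv] ⊗ [Δv] dℓ / |Δv|`) — the second
hypothesis of Compensated Integrability (Serre 2024 §1.1, Thms. 3 and 11).
[cite: Serre2024, §1.1 and §5 p. 1438] -/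
theorem billiardTensor_isPosSemidef (h : IsHardSphereTrajectory (Torus.geometry d) ε N γ)
    (hε : 0 ≤ ε) (a b : ℝ) : (billiardTensor ε γ a b).IsPosSemidef := by
  intro A
  by_cases hA : MeasurableSet A
  · rw [billiardTensor, MatrixMeasure.eval_add]
    exact (h.posSemidef_particleTensor_eval a b hA).add (h.posSemidef_collitonTensor_eval hε a b hA)
  · have h0 : (billiardTensor ε γ a b).eval A = 0 := by
      ext α β
      simp only [MatrixMeasure.eval_apply, Matrix.zero_apply]
      exact VectorMeasure.not_measurable _ hA
    rw [h0]
    exact Matrix.PosSemidef.zero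

end IsHardSphereTrajectory

end Colliton

end

end Literature.Analysis.FluidPDE
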